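import Summits.QuantumFields.YangMills.Theorems.BalabanUVNodesN22W1RelCentredDatumKnitL2UKeyedCoPH
import Summits.QuantumFields.YangMills.Theorems.BalabanUVNodesN22W1RelCentredSliceInputsL2UWitness
import Summits.QuantumFields.YangMills.Theorems.BalabanUVNodesN22W1RelCentredJointNumerals
import Summits.QuantumFields.YangMills.Theorems.BalabanUVNodesN18HLayerW1SpaceRestr

/-!
# BalabanUVNodes ∕ node N22 = NE9 — THE RELATIVE-DISC CENTRED ROAD OVER THE ADMISSIBLE CLASS, MODULE J21 (A6): THE LOCATED TUPLE OF THE K3⁷-FACING BINDER J19 IS INHABITED —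
# `hnum ∧ hdata` of `n22_tupleReadingOfRecordCoPHOn_unscaledLawDatumL2U₀_of_n18Below` at the regime `Rg F θ := θ.γ ≤ ½`, for EVERY admissible tuple, at ONE explicit instantiation of the
# storey's file-level data (`c := consts`, `L := 8`, the degenerate datum family of J17-W §3, the space tables of the unit residual recipe, letter inputs `li`)

Cell `pub-ymgap`, HUMAN RULING D-0062 (Track A), R134 ACCELERATION re-seat `pub-ymgap-dag-n22-c` (strategy s1), generation 10, file J21.  THEOREMS ONLY; imports J19 `…DatumKnitL2UKeyedCoPH`
(the binder storeys; through it the `Stage13HParams` ∕ `Provisos₁₃CoPH` vocabulary), J17-W `…SliceInputsL2UWitness` (`locatedAntecedentL2U_inhabited`: ONE degenerate datum family + unscaled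
data + the unscaled-field law + a `SliceInputsL2U` record at every slice), J14 `…JointNumerals` (the knit's numerals at `consts`: `lemma3Numerics_consts_anyM_fifth`, `consts_α₆_ne_zero`,
`stripNumerics_consts`, dag-n18-c `smallKP_consts_strict`, `numerics_nonvacuous_pos_consts`, R2's `two_mul_exp_le_exp_add_log_two`) and dag-n18-c's `…N18HLayerW1SpaceRestr`
(`spRestr_spaceOfRecord_unit`: the restriction law of W1's tables for the unit residual recipe) BY NAME.  `--supports` K3⁷ `SpineGivenEndpointR13SepCoPH` (stmt-QuantumFields-20544) as a
helper.

WHY (standing rule №189 ∕ №193, A6: a binder storey's located antecedent must be shown inhabited, lest it be VACUOUS-ι).  Module J19's storeys conclude N22's conjunct of `KeyedRates`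
from `h18` (node N18 below — N18's), `hnum` (letter signs) and `hdata` (per tuple ∃: tables' inclusion + restriction law, the capstone ∕ [KP86] ∕ slack ∕ S25 ∕ renewal numerals,
apertures, the unscaled-field law of a datum family, a thickening, ONE `SliceInputsL2U` record per slice, `li.r ≤ min(cA,1)`).  THIS FILE exhibits, for ANY setting family `Sgf F θ`
and ANY `cs₀ : SFConsts`, explicit file-level data — `c := consts`, `L := 8`, the space tables `sp F θ k j Y := U^c_j(Y; cs₀.α₀, cs₀.α₁)` of `(Sgf F θ, Residual.unit)`, letter inputs
`li := ⟨consts.κ, ½, 0, 0, 0, 1, 7, 1, 1∕400, ½⟩`, and the datum family `𝔇 F θ k :=` (a choice of) J17-W §3's degenerate family at `(consts, F.P k, M_N(ℂ), θ.τ9.M, 8)` — under which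
`hnum` AND `hdata` of J19 §2's GUARDED storey HOLD for every `ksel`, every family `F` and every ADMISSIBLE tuple `θ` of the regime `θ.γ ≤ ½` ([I] p. 263: `γ` bounds the couplings, small):
`NeZero θ.τ9.M` from Stage-9 admissibility (`1 ≤ M`), `Sg := Sgf F θ`, `Rz := Residual.unit`, `cs := cs₀`, socket letters `(aw + 40M, 1, 1, 1∕5 + log 2, 1)`, `r₁ := consts.κ`,
`E₀ := consts.E₀ = 2`, `a₅ := 1∕5`, `Mv := 3∕2`, `cA := 1∕400`, `cP := 1∕200`, `ρb := 1∕100`, `Wt := univ`; `hspk` by `Subset.rfl`, `hrestr` by `spRestr_spaceOfRecord_unit`, the numerals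
by J14's ingredients, the law + the records by `locatedAntecedentL2U_inhabited` (`E₀ = 2 ≥ 0`, `κ_E := consts.κ`), `hWsp` by `subset_univ`.  So the binder is NOT vacuous: modulo
`h18` (N18's) its antecedent is inhabited at every admissible tuple of the regime — by DEGENERATE data (vanishing potentials, free kernels), NOT Bałaban's.

HONEST FRAMING.  Count-neutral A6 certificate; the inhabitant is degenerate and says nothing about the datum OF RECORD (NODE A ∕ N09 ∕ N10 ∕ definers); the regime `θ.γ ≤ ½` is
displayed, not derived (admissibility gives `0 < γ` only); `h18` is NOT witnessed; nothing of Bałaban's asserted; N22 NOT discharged (typed 28∕28 · discharged 5∕27 UNCHANGED); one finite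
four-torus programme at fixed ε — NOT infinite volume, NOT OS on ℝ⁴, NOT a mass gap, NOT Clay.  0 `sorry`, 0 `def`, standard axioms (`Classical.choose` on J17-W §3's existential).

References (TYPES ∕ loci only): [I] = [Balaban1987RG1] §1 p. 263, (2.9)–(2.13) pp. 266–268; [II] = [Balaban1988RG2Cluster] (2.3) p. 12, (2.14)–(2.15) p. 15, (2.22) p. 16, Lemma 3
p. 20, (2.39)–(2.41) p. 21 and the closing paragraph p. 21.
-/

noncomputable section

open scoped Matrix.Norms.L2Operator

namespace YMDAG.N22.W1

open Set Metric
open scoped BigOperators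
open Literature.MathematicalPhysics.QuantumFieldTheory.Balaban1983to89
open Literature.MathematicalPhysics.QuantumFieldTheory.Balaban1983to89.T4Continuum
open Literature.MathematicalPhysics.QuantumFieldTheory.Balaban1983to89.T4OutputRate
open Literature.MathematicalPhysics.QuantumFieldTheory.Balaban1983to89.TreeLengthTorus (TPt TDom tsys torusTreeLen torusTreeLen_nonneg)
open Literature.MathematicalPhysics.QuantumFieldTheory.Balaban1983to89.B12TreeDecay (K₀ K₀_pos)
open Literature.MathematicalPhysics.QuantumFieldTheory.Balaban1983to89.B13Lemma3TorusTerms (terms weight)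
open Literature.MathematicalPhysics.QuantumFieldTheory.Balaban1983to89.B13Lemma3TorusSocket (Lemma3Numerics)
open Literature.MathematicalPhysics.QuantumFieldTheory.Balaban1983to89.B13Lemma3WindowNonvacuity (aw)
open Literature.MathematicalPhysics.QuantumFieldTheory.Balaban1983to89.B13Lemma3TorusNonvacuity (consts numerics_nonvacuous_pos_consts consts_L)
open Literature.MathematicalPhysics.QuantumFieldTheory.Balaban1983to89.B13Bound143 (invTau)
open Literature.MathematicalPhysics.QuantumFieldTheory.Balaban1983to89.Step (SFConsts)
open Literature.MathematicalPhysics.QuantumFieldTheory.Balaban1983to89.Node00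
  (Stage12Params Stage13Params Stage13HParams U3Objects₁₁ U3Letters₁₁ NE2Objects₁₁ NE3Letters₁₁ MatA ιSU prependCoupling)
open Literature.MathematicalPhysics.QuantumFieldTheory.Balaban1983to89.Node00.Sect2 (domSys domCount CPair ofBackgroundC spaceI domSites Setting Residual)
open Literature.MathematicalPhysics.QuantumFieldTheory.Balaban1983to89.Node00.W1
open Summit.QuantumFields.YangMills.BalabanUVNodes.N18HLayerW1NumeralsStrict (smallKP_consts_strict)
open Summit.QuantumFields.YangMills.BalabanUVNodes.N18HLayerW1SpaceRestr (spRestr_spaceOfRecord_unit)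
open YMDAG.UVSplit

variable {N : ℕ} [NeZero N]

open Classical in
/-- **★ A6: THE LOCATED TUPLE OF THE K3⁷-FACING BINDER J19 (§2, GUARDED BY `θ.γ ≤ ½`) IS INHABITED AT EVERY ADMISSIBLE TUPLE** — for any setting family `Sgf` and any `cs₀ : SFConsts` there are
letter inputs `li` and a datum family `𝔇` (explicit: `li := ⟨consts.κ, ½, 0, 0, 0, 1, 7, 1, 1∕400, ½⟩`; `𝔇 F θ k` = a choice of module J17-W §3's degenerate family at `(consts, F.P k, M_N(ℂ),
θ.τ9.M, 8)`) such that, with `c := consts`, `L := 8` and the space tables `sp F θ k j Y := spaceI (Sgf F θ) Residual.unit θ.τ9.M j (domSites … Y) cs₀.α₀ cs₀.α₁`, BOTH hypotheses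
`hnum` and `hdata` of `n22_tupleReadingOfRecordCoPHOn_unscaledLawDatumL2U₀_of_n18Below … (Rg := fun F θ ↦ θ.γ ≤ ½)` hold for every `ksel`, `F`, every admissible `θ` with `θ.γ ≤ ½`, every
`g₀ os` — conjunct for conjunct in the storey's binder shape (the proviso core `hP` is not needed).  DEGENERATE data; `h18` not witnessed.
[cite: Balaban1987RG1, §1 p.263 and (2.9)-(2.13) pp.266-268; Balaban1988RG2Cluster, (2.3) p.12, (2.14) p.15, (2.22) p.16, Lemma 3 p.20 and (2.39)-(2.41) p.21 (degenerate data; bookkeeping)] -/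
theorem keyedTupleL2U₀_inhabited_of_gamma_le_half {G : Type*} [GaugeGroup G] (Sgf : (F : T4Family) → Stage13HParams F N → Setting (MatA N) G) (cs₀ : SFConsts) :
    ∃ (li : (F : T4Family) → Stage13HParams F N → LetterInputs)
      (𝔇 : (F : T4Family) → (θ : Stage13HParams F N) → (k : ℕ) → TermData214 consts (F.P k) (MatA N) θ.τ9.M 8),
      ∀ (ksel : (F : T4Family) → Stage13HParams F N → (ℕ → ℝ) → List (ULoop F) → ℕ) (F : T4Family) (θ : Stage13HParams F N),
        θ.γ ≤ 1 / 2 → θ.Admissible F N → ∀ (g₀ : ℕ → ℝ) (os : List (ULoop F)),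
        (0 < (li F θ).C₀ ∧ 0 < (li F θ).θ₅ ∧ (li F θ).θ₅ < 1 ∧ 0 ≤ (li F θ).C₅ ∧ 2 * (li F θ).C₅ / (1 - (li F θ).θ₅) ≤ (li F θ).C₀ ∧ 0 < (li F θ).A ∧
          (li F θ).μ = 1 ∧ 0 < (li F θ).r ∧ (li F θ).s = (2 : ℝ)⁻¹) ∧
        ∃ (_ : NeZero θ.τ9.M) (Sg : Setting (MatA N) G) (Rz : Residual (F.P (ksel F θ g₀ os)) (MatA N))
          (cs : SFConsts) (a a₂ a₂' a₅ a₅' Aabs r₁ E₀ Mv cA cP ρb : ℝ)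
          (χu χcu : (k' : ℕ) → (𝔇 F θ (ksel F θ g₀ os) k').UnscaledChi) (𝒲 : (k' : ℕ) → (𝔇 F θ (ksel F θ g₀ os) k').UnscaledWilson)
          (𝒪 : (k' : ℕ) → (𝔇 F θ (ksel F θ g₀ os) k').UnscaledOlder)
          (Wt : (k' : ℕ) → (domSys (F.P (ksel F θ g₀ os)) θ.τ9.M (k' + 1)).Dom → Set (CPair (F.P (ksel F θ g₀ os)) (MatA N))),
          (∀ (j : ℕ) (Y : (domSys (F.P (ksel F θ g₀ os)) θ.τ9.M j).Dom),
            spaceI (Sgf F θ) (Node00.Sect2.Residual.unit (F.P (ksel F θ g₀ os)) (MatA N)) θ.τ9.M j (domSites (F.P (ksel F θ g₀ os)) θ.τ9.M j Y) cs₀.α₀ cs₀.α₁ ⊆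
              spaceI Sg Rz θ.τ9.M j (domSites (F.P (ksel F θ g₀ os)) θ.τ9.M j Y) cs.α₀ cs.α₁) ∧
          (∀ j : ℕ, SpRestr (M := θ.τ9.M) (fun Y : (domSys (F.P (ksel F θ g₀ os)) θ.τ9.M (j + 1)).Dom =>
            spaceI Sg Rz θ.τ9.M (j + 1) (domSites (F.P (ksel F θ g₀ os)) θ.τ9.M (j + 1) Y) cs.α₀ cs.α₁)) ∧
          8 ≤ consts.L ∧ consts.L = 8 ∧ Lemma3Numerics consts θ.τ9.M ((consts.L : ℝ) / 2) a a₂ a₂' a₅' Aabs ∧ 0 ≤ consts.C3act * consts.ε₁ ∧ 0 ≤ r₁ ∧ (li F θ).κ ≤ r₁ ∧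
          r₁ + 2 * (64 * Real.log 162) + 2 ≤ (1 - 8 * consts.δ) * ((consts.L : ℝ) / 2) * consts.κ ∧
          consts.C3act * consts.ε₁ * Real.exp (5 * r₁ + 1) * K₀ 64 8 * 9 * 64 < 1 ∧
          Real.exp 1 * 9 * 64 * K₀ 64 8 ^ 2 * (consts.C3act * consts.ε₁) ≤ E₀ ∧
          (∀ (k' : ℕ) (Z : (domSys (F.P (ksel F θ g₀ os)) θ.τ9.M (k' + 1)).Dom), 2 * Real.exp (a₅ * ((Z.1).card : ℝ)) ≤ Real.exp (a₅' * ((Z.1).card : ℝ))) ∧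
          0 < cA ∧ cA < cP ∧ cP < 1 ∧ cP / (1 - cP) < ρb ∧ 0 < Mv ∧ (1 - cP)⁻¹ ^ 2 * Mv * ((1 + cA) * θ.γ) ^ 2 ≤ 1 / 2 ∧
          2 * ((1 - cP)⁻¹ ^ 2 * Mv) * E₀ * (1 + cA) ^ 2 ≤ (li F θ).A ∧
          (𝔇 F θ (ksel F θ g₀ os)).UnscaledFieldLawOn χu χcu 𝒲 𝒪 θ.γ ∧ 1 ≤ consts.κ₁ ∧ consts.α₆ ≠ 0 ∧ ρb < 1 ∧
          (∀ (k' : ℕ) (X : (domSys (F.P (ksel F θ g₀ os)) θ.τ9.M (k' + 1)).Dom),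
            spaceI Sg Rz θ.τ9.M (k' + 1) (domSites (F.P (ksel F θ g₀ os)) θ.τ9.M (k' + 1) X) cs.α₀ cs.α₁ ⊆ Wt k' X) ∧
          (∀ k' : ℕ, k' < ksel F θ g₀ os → ∀ (X Z : (domSys (F.P (ksel F θ g₀ os)) θ.τ9.M (k' + 1)).Dom), Z.1 ⊆ X.1 → ∀ t ∈ terms 8 θ.τ9.M Z, ∀ s₀ ∈ Ioc (0 : ℝ) θ.γ,
            Nonempty (SliceInputsL2U ((𝔇 F θ (ksel F θ g₀ os)) k') (χu k') (χcu k') (𝒲 k') (𝒪 k') consts Sg Rz cs E₀ (li F θ).κ Z t (Wt k' X) s₀ a a₅ ρb Mv)) ∧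
          (li F θ).r ≤ min cA 1 := by
  -- the two conditions of J17-W §3 on the constants, and the nonnegative (1.18) amplitude `consts.E₀ = 2`
  obtain ⟨hL, -, hC3pos, hκ, -, hlarge, -, hrenew⟩ := stripNumerics_consts
  obtain ⟨-, -, -, -, -, -, -, -, -, -, -, -, -, -, -, -, -, -, -, -, -, -, -, -, -, -, -, -, -, -, -, -, -, -, -, -, -, -, -, hκ₁, hinv⟩ :=
    numerics_nonvacuous_pos_consts
  have hE₀ : consts.E₀ = 2 := rfl
  have hE₀0 : (0 : ℝ) ≤ consts.E₀ := by rw [hE₀]; norm_num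
  have hMv : (1 : ℝ) < 3 / 2 := by norm_num
  refine ⟨fun F θ => ⟨consts.κ, 1 / 2, 0, 0, 0, 1, 7, 1, 1 / 400, (2 : ℝ)⁻¹⟩,
    fun F θ k => Classical.choose (locatedAntecedentL2U_inhabited consts (F.P k) (MatA N) θ.τ9.M 8 hκ₁ hinv (Sgf F θ) (Node00.Sect2.Residual.unit (F.P k) (MatA N)) cs₀ hE₀0 consts.κ
      hMv (aw + 40 * (θ.τ9.M : ℝ)) θ.γ), ?_⟩
  intro ksel F θ hγh hθ g₀ os
  have hγ : 0 < θ.γ := hθ.toStage9.gamma_pos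
  haveI hMz : NeZero θ.τ9.M := ⟨Nat.one_le_iff_ne_zero.mp hθ.toStage9.2.2.2⟩
  -- the degenerate family at the selected run length, its unscaled data, the law and the records (J17-W §3's existential, opened by choice)
  obtain ⟨χu, χcu, 𝒲, 𝒪, hlaw, hrec⟩ := Classical.choose_spec (locatedAntecedentL2U_inhabited consts (F.P (ksel F θ g₀ os)) (MatA N) θ.τ9.M 8 hκ₁ hinv (Sgf F θ)
    (Node00.Sect2.Residual.unit (F.P (ksel F θ g₀ os)) (MatA N)) cs₀ hE₀0 consts.κ hMv (aw + 40 * (θ.τ9.M : ℝ)) θ.γ)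
  have hγ2 : θ.γ ^ 2 ≤ 1 / 4 := by nlinarith
  refine ⟨⟨by norm_num, by norm_num, by norm_num, le_rfl, by norm_num, by norm_num, rfl, by norm_num, rfl⟩, hMz, Sgf F θ, Node00.Sect2.Residual.unit _ _, cs₀,
    aw + 40 * (θ.τ9.M : ℝ), 1, 1, 1 / 5, 1 / 5 + Real.log 2, 1, consts.κ, consts.E₀, 3 / 2, 1 / 400, 1 / 200, 1 / 100, χu, χcu, 𝒲, 𝒪, fun _ _ => univ,
    fun _ _ => Subset.rfl, fun j => spRestr_spaceOfRecord_unit (Sgf F θ) (fun _ => cs₀.α₀) (fun _ => cs₀.α₁) (j + 1), hL, consts_L, lemma3Numerics_consts_anyM_fifth θ.τ9.M,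
    hC3pos, hκ, le_rfl, hlarge, smallKP_consts_strict, hrenew, fun _ Z => two_mul_exp_le_exp_add_log_two (1 / 5) Z,
    by norm_num, by norm_num, by norm_num, by norm_num, by norm_num, ?_, ?_, hlaw, hκ₁, consts_α₆_ne_zero, by norm_num, fun _ _ => subset_univ _,
    fun k' _ X Z _ t _ s₀ hs₀ => hrec k' Z t s₀ hs₀.1, by norm_num⟩
  · nlinarith [hγ2, sq_nonneg θ.γ]
  · show 2 * ((1 - 1 / 200 : ℝ)⁻¹ ^ 2 * (3 / 2)) * consts.E₀ * (1 + 1 / 400) ^ 2 ≤ 7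
    rw [hE₀]; norm_num

/-! ## §2 The guarded storey AT the witness data: N22's conjunct from node N18 below ALONE -/

open Classical in
/-- **★ COROLLARY — J19 §2's GUARDED STOREY AT THE WITNESS DATA: `N22At (rr F θ hP g₀ os).u3` FROM NODE N18 BELOW ALONE**, for every admissible tuple with `θ.γ ≤ ½`: the storey
`n22_tupleReadingOfRecordCoPHOn_unscaledLawDatumL2U₀_of_n18Below` instantiated at `c := consts`, `L := 8`, §1's `li` and `𝔇`, the space tables of the unit recipe, ANY gauge-distance
`gauge ≥ 0`, ANY transport `T₀` preserving those tables (`hT`), ANY carriers `ℓ₃ ne2 ne1` and selector `ksel` — its `hnum` and `hdata` DISCHARGED by §1, leaving `h18` (node N18 at the run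
lengths below the selected one, at the same reading) as the ONLY hypothesis.  The binder is thereby NOT vacuous.  DEGENERATE data (vanishing potentials); NOT a discharge of N22.
[cite: Balaban1987RG1, §1 p.263 and (2.9)-(2.13) pp.266-268; Balaban1988RG2Cluster, (2.14) p.15, Lemma 3 p.20 and (2.39)-(2.41) p.21 (degenerate data; bookkeeping)] -/
theorem n22_tupleReadingOfRecordCoPHOn_of_n18Below_atWitness {G : Type*} [GaugeGroup G] (Sgf : (F : T4Family) → Stage13HParams F N → Setting (MatA N) G) (cs₀ : SFConsts)
    (gauge : (F : T4Family) → (θ : Stage13HParams F N) → (k : ℕ) → GaugeField (F.P k) 0 (Node00.SU N) → GaugeField (F.P k) 0 (Node00.SU N) → ℝ)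
    (hg : ∀ (F : T4Family) (θ : Stage13HParams F N) (k : ℕ) (U U' : GaugeField (F.P k) 0 (Node00.SU N)), 0 ≤ gauge F θ k U U')
    (ℓ₃ : T4Family → NE3Letters₁₁) (ne2 : (F : T4Family) → Stage13HParams F N → (ℕ → ℝ) → List (ULoop F) → ℕ → NE2Objects₁₁)
    (ne1 : (F : T4Family) → Stage13HParams F N → (ℕ → ℝ) → List (ULoop F) → NE1pCarriers) (ksel : (F : T4Family) → Stage13HParams F N → (ℕ → ℝ) → List (ULoop F) → ℕ) :
    ∃ (li : (F : T4Family) → Stage13HParams F N → LetterInputs)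
      (𝔇 : (F : T4Family) → (θ : Stage13HParams F N) → (k : ℕ) → TermData214 consts (F.P k) (MatA N) θ.τ9.M 8),
      ∀ (T₀ : (F : T4Family) → (θ : Stage13HParams F N) → (k : ℕ) → GaugeField (F.P (k + 1)) 0 (Node00.SU N) → GaugeField (F.P k) 0 (Node00.SU N))
        (hT : ∀ (F : T4Family) (θ : Stage13HParams F N) (k : ℕ) (U : GaugeField (F.P (k + 1)) 0 (Node00.SU N)),
          (∀ (j : ℕ) (Y : (domSys (F.P (k + 1)) θ.τ9.M j).Dom), ofBackgroundC (ιSU N) U ∈ (fun (F : T4Family) (θ : Stage13HParams F N) (k j : ℕ) (Y : (domSys (F.P k) θ.τ9.M j).Dom) =>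
        spaceI (Sgf F θ) (Node00.Sect2.Residual.unit (F.P k) (MatA N)) θ.τ9.M j (domSites (F.P k) θ.τ9.M j Y) cs₀.α₀ cs₀.α₁) F θ (k + 1) j Y) →
          ∀ (j : ℕ) (X : (domSys (F.P k) θ.τ9.M j).Dom), ofBackgroundC (ιSU N) (T₀ F θ k U) ∈ (fun (F : T4Family) (θ : Stage13HParams F N) (k j : ℕ) (Y : (domSys (F.P k) θ.τ9.M j).Dom) =>
        spaceI (Sgf F θ) (Node00.Sect2.Residual.unit (F.P k) (MatA N)) θ.τ9.M j (domSites (F.P k) θ.τ9.M j Y) cs₀.α₀ cs₀.α₁) F θ k j X),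
        (∀ (F : T4Family) (θ : Stage13HParams F N) (hP : θ.Provisos₁₃CoPH F N), θ.γ ≤ 1 / 2 → θ.Admissible F N → ∀ (g₀ : ℕ → ℝ) (os : List (ULoop F)),
          ∀ k' : ℕ, k' < ksel F θ g₀ os → N18At (u3OfRecord₁₃ θ.toStage13Params ((ReadingData.ofRecordAdm F θ.τ9.M N (runTowers fun k => toClusterTower ((𝔇 F θ k).Gn₀))
            ((fun (F : T4Family) (θ : Stage13HParams F N) (k j : ℕ) (Y : (domSys (F.P k) θ.τ9.M j).Dom) =>
        spaceI (Sgf F θ) (Node00.Sect2.Residual.unit (F.P k) (MatA N)) θ.τ9.M j (domSites (F.P k) θ.τ9.M j Y) cs₀.α₀ cs₀.α₁) F θ)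
            (gauge F θ) (hg F θ) (T₀ F θ) (hT F θ) (li F θ)).u3Objects θ.γ) k')) →
        ∀ (F : T4Family) (θ : Stage13HParams F N) (hP : θ.Provisos₁₃CoPH F N), θ.γ ≤ 1 / 2 → θ.Admissible F N → ∀ (g₀ : ℕ → ℝ) (os : List (ULoop F)),
          N22At (rateCarriersOfRecord₁₃CoPH (readingOfRecord₁₃CoPH (fun F θ => ReadingData.ofRecordAdm F θ.τ9.M N (runTowers fun k => toClusterTower ((𝔇 F θ k).Gn₀))
            ((fun (F : T4Family) (θ : Stage13HParams F N) (k j : ℕ) (Y : (domSys (F.P k) θ.τ9.M j).Dom) =>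
        spaceI (Sgf F θ) (Node00.Sect2.Residual.unit (F.P k) (MatA N)) θ.τ9.M j (domSites (F.P k) θ.τ9.M j Y) cs₀.α₀ cs₀.α₁) F θ)
            (gauge F θ) (hg F θ) (T₀ F θ) (hT F θ) (li F θ)) ℓ₃ ne2 ne1) F θ hP g₀ os (ksel F θ g₀ os)).u3 := by
  obtain ⟨li, 𝔇, hw⟩ := keyedTupleL2U₀_inhabited_of_gamma_le_half (N := N) Sgf cs₀
  refine ⟨li, 𝔇, fun T₀ hT h18 => ?_⟩
  exact n22_tupleReadingOfRecordCoPHOn_unscaledLawDatumL2U₀_of_n18Below (fun _ _ _ => consts) (fun _ _ _ => 8) 𝔇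
    (fun (F : T4Family) (θ : Stage13HParams F N) (k j : ℕ) (Y : (domSys (F.P k) θ.τ9.M j).Dom) =>
        spaceI (Sgf F θ) (Node00.Sect2.Residual.unit (F.P k) (MatA N)) θ.τ9.M j (domSites (F.P k) θ.τ9.M j Y) cs₀.α₀ cs₀.α₁)
    gauge hg T₀ hT li ℓ₃ ne2 ne1 ksel (fun F θ => θ.γ ≤ 1 / 2) (G := G) h18 (fun F θ _ hRg hθ => (hw ksel F θ hRg hθ (fun _ => 0) []).1)
    fun F θ _ hRg hθ g₀ os => (hw ksel F θ hRg hθ g₀ os).2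

end YMDAG.N22.W1

end
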